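import Mathlib
import HarnessLib
import Summits.NavierStokesRegularity.NavierStokesRegularity.Theorems.TypeIQuarterGateScarEnvelopeTypeIForcedTsaiDefs

/-!
# ARM B, lane E-exact — REPAIRED CURRENCY: the forced-Tsai modulus bound IN THE TYPE-I DECAY CLASS,
  `ForcedTsaiModulusTypeILE C₀ M δ` (ns-wall-extremal typed-currency audit, 2026-08-29)

WHY.  The registered Prop `ForcedTsaiModulusLE M δ` of `…ForcedTsaiDefs` puts NO decay class on the witness `U`, and is
therefore level-blind: the linear strain–rotation fields `U_c(y) = M_c y`, `M_c = diag(−½,−½,1) + c·J` (`J` the rotation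
generator of the `y₁y₂`-plane; `tr M_c = 0`, `M_c + M_c² = diag(−¼−c², −¼−c², 2)` symmetric) are EXACT unbounded Leray
profiles — pressure-free residual `(M_c + M_c²)y` is a gradient, so the vorticity residual vanishes identically — with
constant vorticity `(0,0,2c)`, hence level `2|c|·|B₁₀|^{1/2} ≥ M` for any `M`; so `ForcedTsaiModulusLE M δ ↔ 0 ≤ δ`
(ns-wall-eng-1 g3, `…ForcedTsaiLinearProfile`; confirmed by idea-crit-7 g5 and by the cert hand).  Every kernel row of that
Prop is thus true but says only `0 ≤ δ`; its numerical content is the certified value of the residual/level functionals of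
the NAMED witness field.

THE REPAIR (option R3 of the audit, adopted by the critic; this file = ONE definition + its two structural lemmas):
`ForcedTsaiModulusTypeILE C₀ M δ` adds the conjunct `∀ y, ‖U y‖ ≤ C₀/(1+‖y‖)` with an EXPLICIT constant `C₀` printed per
row — the Type-I decay class of the near-profiles behind wall H3 (PV (1.9); the PREREG portrait field `sup (1+|y|)|U|`).
This class lies in `L^q(ℝ³)` for every `q > 3`, where exact Leray profiles are trivial [Tsai 1998; NRŠ 1996 for `L³`], so
no exact profile trivialises it; the linear family has no finite `C₀`.  NOTHING here claims that the infimum of the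
residual over the class at fixed level is positive — that is the wall's question (23843 / H3, OPEN).  A row of this Prop
is an UPPER bound: «a smooth divergence-free field with `(1+|y|)|U| ≤ C₀`, level `≥ M` and weighted vorticity residual
`≤ δ` EXISTS».  Kept in a separate module (not an append to `…ForcedTsaiDefs`) so that the ~40 certificate modules
importing `…ForcedTsaiDefs` need not be rebuilt.  Nothing here bears on NS regularity.
-/

noncomputable section

set_option linter.dupNamespace false

namespace Summit.NavierStokesRegularity.NavierStokesRegularity.Cruxes.ScarEnvelopeTypeI.ForcedTsai

open MeasureTheory
open scoped ContDiff
open Literature.Analysis.FluidPDE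

/-- **Forced-Tsai modulus bound in the Type-I decay class** `ForcedTsaiModulusTypeILE C₀ M δ`: there is an explicit
smooth divergence-free field `U : ℝ³ → ℝ³` with the TYPE-I DECAY `‖U(y)‖ ≤ C₀/(1+‖y‖)` for all `y`, level
`‖curl U‖_{L²(B₁₀)} ≥ M`, and weighted vorticity residual `(1+|y|)⁵|g|²` integrable with `‖(1+|y|)^{5/2} g‖_{L²} ≤ δ`.
An UPPER-bound / existence statement about near-profiles in the decay class; never an exclusion; the unbounded exact
linear profiles `y ↦ M_c y` (which make the decay-free `ForcedTsaiModulusLE` vacuous) are not in the class. -/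
def ForcedTsaiModulusTypeILE (C₀ M δ : ℝ) : Prop :=
  ∃ U : E3 → E3, ContDiff ℝ ∞ U ∧ VectorCalculus.IsDivFree U ∧ (∀ y, ‖U y‖ ≤ C₀ / (1 + ‖y‖)) ∧ M ≤ lerayLevel U ∧
    Integrable (fun y => (1 + ‖y‖) ^ 5 * ‖lerayVorticityResidual U y‖ ^ 2) ∧ lerayResidualNorm U ≤ δ

/-- Monotonicity: a witness at `(C₀, M, δ)` is a witness at every `C₀ ≤ C₀'`, `M' ≤ M`, `δ ≤ δ'`. -/
theorem ForcedTsaiModulusTypeILE.mono {C₀ M δ C₀' M' δ' : ℝ} (h : ForcedTsaiModulusTypeILE C₀ M δ) (hC : C₀ ≤ C₀')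
    (hM : M' ≤ M) (hδ : δ ≤ δ') : ForcedTsaiModulusTypeILE C₀' M' δ' := by
  obtain ⟨U, hU, hdiv, hdec, hlev, hint, hres⟩ := h
  refine ⟨U, hU, hdiv, fun y => (hdec y).trans ?_, hM.trans hlev, hint, hres.trans hδ⟩
  exact div_le_div_of_nonneg_right hC (by positivity)

/-- The decay-class bound implies the (decay-free, level-blind) registered bound. -/
theorem ForcedTsaiModulusTypeILE.toLE {C₀ M δ : ℝ} (h : ForcedTsaiModulusTypeILE C₀ M δ) : ForcedTsaiModulusLE M δ := by
  obtain ⟨U, hU, hdiv, -, hlev, hint, hres⟩ := h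
  exact ⟨U, hU, hdiv, hlev, hint, hres⟩

end Summit.NavierStokesRegularity.NavierStokesRegularity.Cruxes.ScarEnvelopeTypeI.ForcedTsai

end
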